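/-
Origin: expansion seat `planner-pub-hodgecm-carver-0`, handover 2026-08-18T03:27:49Z (synced 03:34:05Z) (`HOME/pub-hodgecm-carver/lean/Carver/PerL34/Isolation.lean`, md5 06614d08, 119 lines);
landed by the gen-5 packager in gate run 18 as `HodgeCM/PerL34/Isolation.lean` (verbatim).
-/
/-
Origin: HOME/pub-hodgecm-carver/lean/HodgeCM/PerL34/Isolation.lean — session planner-pub-hodgecm-carver-0 (unit
pub-hodgecm-carver, THE CARVER).  Intended final place: `HodgeCM/PerL34/Isolation.lean`.
DAG nodes (HOME/LEMMAS.md §1): N21 (𝒯_Φ paragraph), N22 (spectral paragraph), N23 (Prop 3.6) with its proof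
steps N23a (E^χ_f), N23b (Step 1, unfolding), N23c (Step 2, annihilation), N24 (Thm 3.7).
Nothing is asserted.  `_holds` theorems are either PROJECTIONS of model data (the step is POSITED as a field of
the frozen prior interface `Perl34.IsolationCore` / `TorusData`, FACTS.md A1–A3) or APPLICATIONS of the prior
programme's kernel-checked proofs `Perl34.TorusData.C1_prop36`, `Perl34.IsolationSetting.C2_S12_eq_S34`.
-/
import Summits.HodgeConjecture.HodgeCM.Automorphic.ThetaFacts

set_option autoImplicit false

/-!
# PerL v5 §3.3 — isolation (Prop 3.6) and coincidence of the spans (Thm 3.7): DAG nodes N21–N24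

Verbatim statements: LEMMAS.md §5 (N21 ll. 380–383; N22 ll. 384–396; N23 ll. 397–403 with Steps ll. 405–438;
N24 ll. 440–447 with proof ll. 448–458).
-/

noncomputable section

namespace HodgeCM
namespace PerL34

open HodgeCM.Prior.Perl34File
open scoped InnerProductSpace

variable {U : Universe} (T : U.ThetaModel)

/-- **N22** (PerL v5 §3.3, tex ll. 386–387): "the orthogonal projection `e_{\hat\sigma}` onto `\hat\sigma` lies
in the von Neumann algebra generated by `R(\U(W)(\A))`, hence preserves every closed `R(\U(W)(\A))`-invariant
subspace" + (ll. 435–437) "if `k\ge1` and `w` occurs in `\sigma_\infty|_{T(L_0\otimes\R)}` it would contain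
non-zero `w`-isotypic vectors".  Typed over the model's core; POSITED (fields `AX9_espectral`, `AX9_w_vector`). -/
def N22_spectral : Prop :=
  ∀ {L : CMField} {ι₁ : L →+* ℂ} (V : HermSpace3 L ι₁) (c : SeesawCtx L),
    (∀ (M : Submodule ℂ (T.H V c)), IsClosed (M : Set (T.H V c)) →
      (∀ g, ∀ v ∈ M, (T.core V c).R g v ∈ M) → ∀ i, ∀ v ∈ M, (T.core V c).eσ i v ∈ M) ∧
    (∀ (M : Submodule ℂ (T.H V c)), IsClosed (M : Set (T.H V c)) →
      (∀ g, ∀ v ∈ M, (T.core V c).R g v ∈ M) → ∀ i, (T.t12 V c).wOccurs i →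
        M ⊓ (T.core V c).hatσ i ≠ ⊥ → ∃ v ∈ M ⊓ (T.core V c).hatσ i, v ≠ 0 ∧ (T.t12 V c).Pw v = v)

/-- (Ported verbatim from the HodgeCMPerL package; no docstring in the source.) -/
theorem N22_holds : N22_spectral T :=
  fun V c => ⟨fun M hM hinv i v hv => (T.core V c).AX9_espectral M hM hinv i v hv,
    fun M hM hinv i hi hne => (T.t12 V c).AX9_w_vector M hM hinv i hi hne⟩

/-- **N23a** (PerL v5 Prop 3.6 proof, tex ll. 405–411): "`E^\chi_f(y):=\sum_{\gamma\in T(L_0)\backslash\U(W)(L_0)}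
\Xi^\chi_f(\gamma y)` is a locally finite sum … defining a smooth function on `[\U(W)]` … since
`R(h_0)E^\chi_f=E^\chi_{f^{h_0}}` … its closure `\ol{\mathcal E}` is `R(\U(W)(\A))`-invariant."  Typed as the
translation law of the model's pseudo-Eisenstein vectors; POSITED (field `AX12_E_transl`). -/
def N23a_pseudoEisenstein : Prop :=
  ∀ {L : CMField} {ι₁ : L →+* ℂ} (V : HermSpace3 L ι₁) (c : SeesawCtx L) (h : T.G V c) χ f,
    (T.core V c).R h ((T.t12 V c).E χ f) = (T.t12 V c).E χ ((T.t12 V c).ETransl h χ f)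

/-- (Ported verbatim from the HodgeCMPerL package; no docstring in the source.) -/
theorem N23a_holds : N23a_pseudoEisenstein T := fun V c h χ f => (T.t12 V c).AX12_E_transl h χ f

/-- **N23b** (PerL v5 Prop 3.6 Step 1, tex ll. 413–421): "`\mathcal T_\Phi(E^\chi_f)(g)=\int_{\U(W)(\A)}f(h)\,
\vartheta_{T,\chi}(\omega(h)\Phi)(g)\,dh` … the right-hand side, a Bochner integral of a compactly supported
continuous `S_{12}`-valued function, lies in the closed subspace `S_{12}`."  Typed integral-free (closed-span
membership), exactly as the frozen field `AX12_unfold_lift`; POSITED. -/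
def N23b_unfolding : Prop :=
  ∀ {L : CMField} {ι₁ : L →+* ℂ} (V : HermSpace3 L ι₁) (c : SeesawCtx L) (Φ : T.SK V c) χ f,
    (T.core V c).TΦ Φ ((T.t12 V c).E χ f) ∈ (Submodule.span ℂ
      (Set.range fun h : T.G V c => (T.core V c).inclCG ((T.t12 V c).ϑc χ ((T.core V c).omg h Φ)))).topologicalClosure

/-- (Ported verbatim from the HodgeCMPerL package; no docstring in the source.) -/
theorem N23b_holds : N23b_unfolding T := fun V c Φ χ f => (T.t12 V c).AX12_unfold_lift Φ χ f

/-- **N23c** (PerL v5 Prop 3.6 Step 2, tex ll. 423–434): "`\ol{\mathcal E}\supseteq L^2_w`. Let `v\in\ol{\mathcal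
E}^\perp` … so the continuous function `h\mapsto P_{T,\bar\chi}(R(h)v)` vanishes identically … Hence all Fourier
coefficients of `(R(h_f)v_w)|_{[T]}` vanish … real approximation … Thus `v_w=0`."  Typed as: a vector orthogonal
to every `E^χ_f` has vanishing `w`-isotypic part — the COMPOSITE frozen field `AX8_annihilation`; POSITED
(print content: Fourier analysis on the compact abelian `[T]`, real approximation [San Cor 3.5(iii)], [PR Thm 7.7]). -/
def N23c_annihilation : Prop :=
  ∀ {L : CMField} {ι₁ : L →+* ℂ} (V : HermSpace3 L ι₁) (c : SeesawCtx L) (v : T.H V c),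
    (∀ χ f, ⟪(T.t12 V c).E χ f, v⟫_ℂ = 0) → (T.t12 V c).Pw v = 0

/-- (Ported verbatim from the HodgeCMPerL package; no docstring in the source.) -/
theorem N23c_holds : N23c_annihilation T := fun V c v hv => (T.t12 V c).AX8_annihilation v hv

/-- **N23** (PerL v5 Proposition 3.6 `prop:isol`, tex ll. 397–403): "assume that every character `\chi` of
`[T]` with `\chi_\infty=w` arises from an allowed pair (Lemma~\ref{lem:chars}). Then for every `\Phi\in\cS^\kappa`,
`\mathcal T_\Phi(L^2_w)\subset S_{12}.` The same holds for type `(34)` with `T'`, `w'` and `S_{34}`." -/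
def N23_isolation : Prop :=
  ∀ {L : CMField} {ι₁ : L →+* ℂ} (V : HermSpace3 L ι₁) (c : SeesawCtx L),
    ((∀ χ, (T.t12 V c).allowed χ) → ∀ Φ : T.SK V c, ∀ v ∈ (T.t12 V c).L2w,
      (T.core V c).TΦ Φ v ∈ (T.t12 V c).S12) ∧
    ((∀ χ, (T.t34 V c).allowed χ) → ∀ Φ : T.SK V c, ∀ v ∈ (T.t34 V c).L2w,
      (T.core V c).TΦ Φ v ∈ (T.t34 V c).S12)

/-- N23 is KERNEL-CHECKED over the frozen interface: the prior programme's `Perl34.TorusData.C1_prop36`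
(Prior/Perl34.lean l. 531) proves it from the posited steps N22/N23a–c. -/
theorem N23_holds : N23_isolation T :=
  fun V c => ⟨fun hch Φ => (T.t12 V c).C1_prop36 hch Φ, fun hch Φ => (T.t34 V c).C1_prop36 hch Φ⟩

/-- **N24** (PerL v5 Theorem 3.7 `thm:R`, tex ll. 440–444): "Assume that every character of `[T]` of type `w`
and every character of `[T']` of type `w'` arises from an allowed pair (Lemma~\ref{lem:chars}), and that for every
isotypic component `\hat\sigma` and `\Phi\in\cS^\kappa` with `\mathcal T_\Phi|_{\hat\sigma}\ne0` the type `w` occurs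
in `\sigma_\infty|_{T}` and `w'` in `\sigma_\infty|_{T'}` (Lemma~\ref{lem:arch}(c)). Then `S_{12}=S_{34}`
[`=\ol{\sum_\Phi\mathcal T_\Phi(L^2([\U(W)]))}`]."  Typed with the first equality as conclusion. -/
def N24_coincide : Prop :=
  ∀ {L : CMField} {ι₁ : L →+* ℂ} (V : HermSpace3 L ι₁) (c : SeesawCtx L),
    (∀ χ, (T.t12 V c).allowed χ) → (∀ χ, (T.t34 V c).allowed χ) →
    (∀ (Φ : T.SK V c) i, (∃ v ∈ (T.core V c).hatσ i, (T.core V c).TΦ Φ v ≠ 0) → (T.t12 V c).wOccurs i) →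
    (∀ (Φ : T.SK V c) i, (∃ v ∈ (T.core V c).hatσ i, (T.core V c).TΦ Φ v ≠ 0) → (T.t34 V c).wOccurs i) →
      (T.t12 V c).S12 = (T.t34 V c).S12

/-- N24 is KERNEL-CHECKED over the frozen interface: `Perl34.IsolationSetting.C2_S12_eq_S34` (Prior/Perl34.lean
l. 685) applied to the isolation setting assembled from the model and the four hypotheses. -/
theorem N24_holds : N24_coincide T := by
  intro L ι₁ V c h12 h34 o12 o34
  let S : Perl34.IsolationSetting (T.H V c) (T.HG L ι₁ V) (T.CG V c) (T.G V c) (T.SK V c) (T.SigIdx V c)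
      (T.SigIdxG V c) :=
    { core := T.core V c, t12 := T.t12 V c, t34 := T.t34 V c
      H_chars12 := h12, H_chars34 := h34, H_occ12 := o12, H_occ34 := o34 }
  exact S.C2_S12_eq_S34

end PerL34
end HodgeCM

end
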